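import Literature.Computability.AlgebraicComplexity.BorderRankMatMul323CertData1
import Literature.Computability.AlgebraicComplexity.BorderRankMatMul323CertData2
import Literature.Computability.AlgebraicComplexity.BorderRankMatMul323CertData3
import Literature.Computability.AlgebraicComplexity.BorderRankMatMul323CertData4
import Literature.Computability.AlgebraicComplexity.BorderRankMatMul323CertData5
import Literature.Computability.AlgebraicComplexity.BorderRankMatMul323CertData6
import Literature.Computability.AlgebraicComplexity.BorderRankMatMul323CertData7
import Literature.Computability.AlgebraicComplexity.BorderRankMatMul323CertData8
import HarnessLib

/-!
# The `⟨3,2,3⟩` border apolarity test, torus-fixed candidates (III): soundness of the certificate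

Topic `Literature/Computability/AlgebraicComplexity`.  Assembles the certificate of
`BorderRankMatMul323Cert.lean` / `…CertData1…8.lean` and proves its meaning:

* `certList323`, `certList323_ok` — all `322` entries are valid (the data files' kernel runs);
* `omitsTable_realised` — every entry of `omitsTable` is the omitted set of a certificate (kernel run);
* `MatMul323.rank_test_ge_of_omits` — **SOUNDNESS of one entry**: for every field `K` of
  characteristic `0`, every table entry `T ∈ omitsTable` and every set `S` of weight lines containing
  all lines outside `T`, the `(210)` products `{ω_k · e_a : k ∈ S, a}` span dimension `≥ 114`
  (`> dim S²A* ⊗ B* − 13 = 113`) or the `(120)` products span dimension `≥ 114`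
  (`> dim A* ⊗ S²B* − 13`).  The extension to ALL `S` with `|S| ≥ 23` by the Weyl group is
  `BorderRankMatMul323Symmetry.lean`.

## References

* A. Conner, A. Harper, J. M. Landsberg, *New lower bounds for matrix multiplication and `det₃`*,
  Forum Math. Pi 11 (2023) e17 = arXiv:1911.07981, Thm. 1.4(1) (= Thm. 1.5(1) of the journal
  version), §2.3–§2.5, §3 (tests), §4 (`M(C*)^⊥ = U* ⊗ 𝔰𝔩(V) ⊗ W`), §7.3 ("nine `𝔹`-fixed
  four-dimensional subspaces"). [ConnerHarperLandsberg2023]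
-/

namespace Literature.Computability.AlgebraicComplexity

namespace MatMul323

/-! ## The full certificate list and its validity -/

/-- All `322` certificates. [cite: ConnerHarperLandsberg2023, Thm. 1.4(1) and §7.3 (the (210)- and (120)-tests for M_⟨233⟩)] -/
def certList323 : List CertEntry4 :=
  certData323_1 ++ certData323_2 ++ certData323_3 ++ certData323_4 ++ certData323_5 ++ certData323_6 ++ certData323_7 ++ certData323_8

/-- Every certificate is valid (the data files' kernel runs, concatenated). [cite: ConnerHarperLandsberg2023, Thm. 1.4(1) and §7.3 (the (210)- and (120)-tests for M_⟨233⟩)] -/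
theorem certList323_ok : checkChunk4 certList323 = true :=
  checkChunk4_append (checkChunk4_append (checkChunk4_append (checkChunk4_append (checkChunk4_append (checkChunk4_append (checkChunk4_append certData323_1_ok certData323_2_ok) certData323_3_ok) certData323_4_ok) certData323_5_ok) certData323_6_ok) certData323_7_ok) certData323_8_ok

/-- Every tabulated omitted set is realised by a certificate. [cite: ConnerHarperLandsberg2023, Thm. 1.4(1) and §7.3 (the (210)- and (120)-tests for M_⟨233⟩)] -/
def omitsRealised : Bool :=
  omitsTable.all fun T => certList323.any fun e => [e.p, e.q, e.s, e.t] == T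

/-- **Kernel run**: `omitsRealised`. [cite: ConnerHarperLandsberg2023, Thm. 1.4(1) and §7.3 (the (210)- and (120)-tests for M_⟨233⟩)] -/
theorem omitsRealised_eq_true : omitsRealised = true := by
  decide +kernel

/-! ## Soundness of the checker -/

/-- A tabulated omitted set has a valid certificate. [cite: ConnerHarperLandsberg2023, Thm. 1.4(1) and §7.3 (the (210)- and (120)-tests for M_⟨233⟩)] -/
theorem exists_certEntry4 {T : List ℕ} (hT : T ∈ omitsTable) :
    ∃ e ∈ certList323, [e.p, e.q, e.s, e.t] = T ∧ e.ok = true := by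
  have h := omitsRealised_eq_true
  unfold omitsRealised at h
  rw [List.all_eq_true] at h
  obtain ⟨e, he, hpe⟩ := List.any_eq_true.1 (h T hT)
  have hv := certList323_ok
  unfold checkChunk4 at hv
  rw [List.all_eq_true] at hv
  exact ⟨e, he, beq_iff_eq.1 hpe, hv e he⟩

/-- What a valid entry guarantees: the row count and, for each row `i < 114`, an allowed weight line,
a nonzero diagonal value and zeros left of the diagonal. [cite: ConnerHarperLandsberg2023, Thm. 1.4(1) and §7.3 (the (210)- and (120)-tests for M_⟨233⟩)] -/
theorem CertEntry4.ok_spec {e : CertEntry4} (h : e.ok = true) :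
    e.rows.length = 114 ∧ ∀ i < 114,
      ((e.row i).1 < 27 ∧ (e.row i).1 ≠ e.p ∧ (e.row i).1 ≠ e.q ∧ (e.row i).1 ≠ e.s ∧
          (e.row i).1 ≠ e.t) ∧
        e.val i i ≠ 0 ∧ ∀ j < i, e.val i j = 0 := by
  unfold CertEntry4.ok at h
  simp only [Bool.and_eq_true, List.all_eq_true, List.mem_range, decide_eq_true_eq,
    beq_iff_eq] at h
  obtain ⟨hlen, h⟩ := h
  refine ⟨hlen, fun i hi => ?_⟩
  obtain ⟨⟨h1, h2⟩, h3⟩ := h i hi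
  exact ⟨h1, h2, fun j hj => h3 j (by omega) hj⟩

section Soundness

variable (K : Type*) [Field K] [CharZero K]

omit [CharZero K] in
/-- Rows with an upper triangular matrix of pivot values (nonzero diagonal) span dimension `≥ n`
inside any set containing them. [folklore] -/
private theorem le_finrank_span_of_triangular {ι : Type*} [Fintype ι] {n : ℕ} (r : Fin n → (ι → K))
    (π : Fin n → ι) (hdiag : ∀ i, r i (π i) ≠ 0) (hupper : ∀ i j : Fin n, j < i → r i (π j) = 0)
    {T : Set (ι → K)} (hsub : ∀ i, r i ∈ T) : n ≤ Module.finrank K (Submodule.span K T) := by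
  classical
  let N : Matrix (Fin n) (Fin n) K := fun i j => r i (π j)
  have hdet : N.det ≠ 0 := by
    rw [Matrix.det_of_upperTriangular]
    · exact Finset.prod_ne_zero_iff.2 fun i _ => hdiag i
    · intro i j hij
      exact hupper i j hij
  have hli : LinearIndependent K r := by
    have hrows : LinearIndependent K (fun i => N i) :=
      Matrix.linearIndependent_rows_of_det_ne_zero hdet
    have hcomp : (fun i => N i) = (LinearMap.funLeft K K π) ∘ r := by
      funext i j; rfl
    rw [hcomp] at hrows
    exact LinearIndependent.of_comp _ hrows
  have hsub' : Set.range r ⊆ T := by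
    rintro _ ⟨i, rfl⟩; exact hsub i
  calc n = Fintype.card (Fin n) := (Fintype.card_fin n).symm
    _ = Module.finrank K (Submodule.span K (Set.range r)) := (finrank_span_eq_card hli).symm
    _ ≤ _ := Submodule.finrank_mono (Submodule.span_mono hsub')

/-- **Soundness of one certificate entry.** For every field `K` of characteristic `0`, every
tabulated (canonical) omitted `4`-set `T` and every set `S` of weight lines of `M_⟨323⟩(C*)^⊥`
containing all lines outside `T`, the `(210)` products `{ω_k · e_a : k ∈ S, a}` span dimension
`≥ 114` or the `(120)` products `{ω_k · e_b : k ∈ S, b}` span dimension `≥ 114` — the `⟨3,2,3⟩`,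
`r = 13` case of the border apolarity tests of CHL 2023, §3, for the torus-fixed `F₁₁₀` indexed by
the orbit representatives (their §7.3 treats the nine Borel-fixed ones of `M_⟨233⟩`).
[cite: ConnerHarperLandsberg2023, Thm. 1.4(1) and §7.3 (the (210)- and (120)-tests for M_⟨233⟩)] -/
theorem rank_test_ge_of_omits {T : List ℕ} (hT : T ∈ omitsTable) (S : Finset (Fin 27))
    (hS : ∀ k : Fin 27, k.val ∉ T → k ∈ S) :
    114 ≤ Module.finrank K (Submodule.span K (genSetA K S)) ∨
      114 ≤ Module.finrank K (Submodule.span K (genSetB K S)) := by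
  classical
  obtain ⟨e, -, heT, hok⟩ := exists_certEntry4 hT
  obtain ⟨-, hspec⟩ := CertEntry4.ok_spec hok
  -- membership of the rows' weight lines in `S`
  have hmemS : ∀ i < 114, decK (e.row i).1 ∈ S := by
    intro i hi
    have h1 := (hspec i hi).1
    have hval : (decK (e.row i).1).val = (e.row i).1 := Nat.mod_eq_of_lt h1.1
    apply hS
    rw [hval, ← heT]
    simp only [List.mem_cons, List.not_mem_nil, or_false, not_or]
    exact ⟨h1.2.1, h1.2.2.1, h1.2.2.2.1, h1.2.2.2.2⟩
  cases ht : e.test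
  · -- the `(210)` test
    left
    refine le_finrank_span_of_triangular K
      (fun i : Fin 114 => rowFunA K (decK (e.row i).1) (decA (e.row i).2.1))
      (fun j : Fin 114 => decTA (e.row j).2.2) ?_ ?_ ?_
    · intro i
      have h := (hspec i i.isLt).2.1
      simp only [CertEntry4.val, ht] at h
      rw [rowFunA_eq_cast, Int.cast_ne_zero]
      exact h
    · intro i j hij
      have h := (hspec i i.isLt).2.2 j hij
      simp only [CertEntry4.val, ht] at h
      rw [rowFunA_eq_cast, Int.cast_eq_zero]
      exact h
    · intro i
      exact ⟨decK (e.row i).1, hmemS i i.isLt, decA (e.row i).2.1, rfl⟩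
  · -- the `(120)` test
    right
    refine le_finrank_span_of_triangular K
      (fun i : Fin 114 => rowFunB K (decK (e.row i).1) (decB (e.row i).2.1))
      (fun j : Fin 114 => decTB (e.row j).2.2) ?_ ?_ ?_
    · intro i
      have h := (hspec i i.isLt).2.1
      simp only [CertEntry4.val, ht] at h
      rw [rowFunB_eq_cast, Int.cast_ne_zero]
      exact h
    · intro i j hij
      have h := (hspec i i.isLt).2.2 j hij
      simp only [CertEntry4.val, ht] at h
      rw [rowFunB_eq_cast, Int.cast_eq_zero]
      exact h
    · intro i
      exact ⟨decK (e.row i).1, hmemS i i.isLt, decB (e.row i).2.1, rfl⟩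

end Soundness

end MatMul323

end Literature.Computability.AlgebraicComplexity
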